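import Mathlib.Analysis.Convex.Deriv
import Mathlib.Analysis.Calculus.Deriv.Pow

/-!
# `StrictSplittingRule` (stmt-AtomisticToContinuum-12560), H12⋆ architecture, NEAR half: the BOX / INTERPOLATION lemma

PART B of cell `b2b-freesplit-r2` (route `FreeSplittingCertificates`), item (4) of the far-lemma specification
(`FAR-LEMMA-SPEC §12 (d)`): the near certificate of the χ-split is an exact LMI `A(a,h) ⪰ m·G` certified at finitely many
rational points `(a,h)` of the tree enclosure of the hcp-family minimiser (`hcpFamilyMin_enclosure`: the box
`|a − 97129/10⁵| ≤ 10⁻⁴`, `|h − 79294/10⁵| ≤ 10⁻⁴`).  To pass from a rectangular GRID of certified points to EVERY point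
of the box one uses, for each fixed test vector `z`, the scalar function `F(a,h) = zᵀA(a,h)z` and the elementary

**interpolation lemma.**  If `x ↦ f x − (B/2)x²` is concave on `[x₀,x₁]` (e.g. `f'' ≤ B` there,
`concave_shift_of_deriv2_le`), then on `[x₀,x₁]` the graph of `f` lies above its chord minus `(B/2)(x−x₀)(x₁−x)`, hence
above `min (f x₀) (f x₁) − (B/8)(x₁−x₀)²` (`interp_lower_of_concave`, `interp_lower_min`); and on a rectangle, applying this
in `a` at every `h` and in `h` on the two vertical edges, `F ≥ m − (B₁(a₁−a₀)² + B₂(h₁−h₀)²)/8` whenever `F ≥ m` at the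
four corners (`box_lower_of_concave`, `box_lower_of_deriv2_le`).

These are the kernel side of CERT §22 (HOME `run/shared/lean/b2b/freesplit-r2/`): the second-derivative bounds `B₁, B₂` of
the near ledger over the box are certified there by rigorous range automatic differentiation (python/interval tier) and the
corner inequalities by exact integer `LDLᵀ`; a kernel model of the near ledger (item (5)) would instantiate `F` here.
Value = a reusable certificate-glue lemma; NOT a proof of H12⋆, NOT summit progress.
-/

noncomputable section

namespace Summit.AtomisticToContinuum.Crystallization.Theorems.StrictSplittingRuleBirth

open Set

/-- **Chord-minus-parabola lower bound.**  If `x ↦ f x − (B/2)·x²` is concave on `[x₀, x₁]`, then for every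
`x ∈ [x₀, x₁]`, `f x ≥ ℓ(x) − (B/2)(x − x₀)(x₁ − x)` where `ℓ` is the chord of `f` through the endpoints. -/
theorem interp_lower_of_concave {f : ℝ → ℝ} {x₀ x₁ B : ℝ} (hlt : x₀ < x₁)
    (hc : ConcaveOn ℝ (Icc x₀ x₁) (fun x => f x - B / 2 * x ^ 2)) {x : ℝ} (hx : x ∈ Icc x₀ x₁) :
    ((x₁ - x) * f x₀ + (x - x₀) * f x₁) / (x₁ - x₀) - B / 2 * ((x - x₀) * (x₁ - x)) ≤ f x := by
  have hdpos : 0 < x₁ - x₀ := sub_pos.mpr hlt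
  have hdne : x₁ - x₀ ≠ 0 := hdpos.ne'
  set t := (x - x₀) / (x₁ - x₀) with ht
  have ht0 : 0 ≤ t := div_nonneg (sub_nonneg.mpr hx.1) hdpos.le
  have ht1 : t ≤ 1 := by rw [ht, div_le_one hdpos]; linarith [hx.2]
  have hxe : x = x₀ + t * (x₁ - x₀) := by rw [ht]; field_simp; ring
  have hxt : (1 - t) • x₀ + t • x₁ = x := by
    simp only [smul_eq_mul]; rw [hxe]; ring
  have key := hc.2 (left_mem_Icc.mpr hlt.le) (right_mem_Icc.mpr hlt.le) (sub_nonneg.mpr ht1) ht0 (by ring)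
  rw [hxt] at key
  simp only [smul_eq_mul] at key
  have h1 : ((x₁ - x) * f x₀ + (x - x₀) * f x₁) / (x₁ - x₀) = (1 - t) * f x₀ + t * f x₁ := by
    rw [hxe]; field_simp; ring
  have h2 : (x - x₀) * (x₁ - x) = ((1 - t) * x₀ ^ 2 + t * x₁ ^ 2) - x ^ 2 := by
    rw [hxe]; ring
  rw [h1, h2]; linarith

/-- **Interpolation error bound, one variable.**  If `x ↦ f x − (B/2)·x²` is concave on `[x₀, x₁]` with `B ≥ 0`
and `f ≥ m` at both endpoints, then `f ≥ m − (B/8)(x₁ − x₀)²` on `[x₀, x₁]`. -/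
theorem interp_lower_min {f : ℝ → ℝ} {x₀ x₁ B : ℝ} (hlt : x₀ < x₁) (hB : 0 ≤ B)
    (hc : ConcaveOn ℝ (Icc x₀ x₁) (fun x => f x - B / 2 * x ^ 2)) {x : ℝ} (hx : x ∈ Icc x₀ x₁) {m : ℝ}
    (h0 : m ≤ f x₀) (h1 : m ≤ f x₁) : m - B / 8 * (x₁ - x₀) ^ 2 ≤ f x := by
  have hmain := interp_lower_of_concave hlt hc hx
  have hq : (x - x₀) * (x₁ - x) ≤ (x₁ - x₀) ^ 2 / 4 := by nlinarith [sq_nonneg (x - x₀ - (x₁ - x))]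
  have hl : m ≤ ((x₁ - x) * f x₀ + (x - x₀) * f x₁) / (x₁ - x₀) := by
    rw [le_div_iff₀ (sub_pos.mpr hlt)]
    have e0 := mul_le_mul_of_nonneg_left h0 (sub_nonneg.mpr hx.2)
    have e1 := mul_le_mul_of_nonneg_left h1 (sub_nonneg.mpr hx.1)
    nlinarith
  have hB2 : B / 2 * ((x - x₀) * (x₁ - x)) ≤ B / 2 * ((x₁ - x₀) ^ 2 / 4) :=
    mul_le_mul_of_nonneg_left hq (by positivity)
  linarith

/-- **Second derivative ⇒ the concavity hypothesis.**  If `f` has first and second derivatives `f'`, `f''` at every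
point of `[x₀, x₁]` and `f'' ≤ B` there, then `x ↦ f x − (B/2)·x²` is concave on `[x₀, x₁]`. -/
theorem concave_shift_of_deriv2_le {f f' f'' : ℝ → ℝ} {x₀ x₁ B : ℝ}
    (hf : ∀ x ∈ Icc x₀ x₁, HasDerivAt f (f' x) x) (hf' : ∀ x ∈ Icc x₀ x₁, HasDerivAt f' (f'' x) x)
    (hB : ∀ x ∈ Icc x₀ x₁, f'' x ≤ B) :
    ConcaveOn ℝ (Icc x₀ x₁) (fun x => f x - B / 2 * x ^ 2) := by
  have hsq : ∀ x : ℝ, HasDerivAt (fun x => B / 2 * x ^ 2) (B * x) x := by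
    intro x
    have h := (hasDerivAt_pow 2 x).const_mul (B / 2)
    refine h.congr_deriv ?_
    rw [show (2 : ℕ) - 1 = 1 from rfl, pow_one]
    push_cast
    ring
  have hlin : ∀ x : ℝ, HasDerivAt (fun x => B * x) B x := by
    intro x
    simpa using (hasDerivAt_id x).const_mul B
  refine concaveOn_of_hasDerivWithinAt2_nonpos (convex_Icc x₀ x₁) (f' := fun x => f' x - B * x)
    (f'' := fun x => f'' x - B) ?_ ?_ ?_ ?_
  · intro x hx
    exact (((hf x hx).sub (hsq x)).continuousAt).continuousWithinAt
  · intro x hx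
    exact ((hf x (interior_subset hx)).sub (hsq x)).hasDerivWithinAt
  · intro x hx
    exact ((hf' x (interior_subset hx)).sub (hlin x)).hasDerivWithinAt
  · intro x hx
    have := hB x (interior_subset hx)
    show f'' x - B ≤ 0
    linarith

/-- **The box lemma (concavity form).**  On the rectangle `[a₀,a₁] × [h₀,h₁]`: if `a ↦ F a h − (B₁/2)a²` is concave
for every `h`, `h ↦ F aᵢ h − (B₂/2)h²` is concave on the two vertical edges, and `F ≥ m` at the four corners, then
`F ≥ m − (B₁(a₁−a₀)² + B₂(h₁−h₀)²)/8` on the whole rectangle.  (Bilinear-interpolation error bound: the bilinear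
interpolant is a convex combination of the corner values.) -/
theorem box_lower_of_concave {F : ℝ → ℝ → ℝ} {a₀ a₁ h₀ h₁ B₁ B₂ m : ℝ} (ha : a₀ < a₁) (hh : h₀ < h₁)
    (hB₁ : 0 ≤ B₁) (hB₂ : 0 ≤ B₂)
    (hca : ∀ h ∈ Icc h₀ h₁, ConcaveOn ℝ (Icc a₀ a₁) (fun a => F a h - B₁ / 2 * a ^ 2))
    (hch₀ : ConcaveOn ℝ (Icc h₀ h₁) (fun h => F a₀ h - B₂ / 2 * h ^ 2))
    (hch₁ : ConcaveOn ℝ (Icc h₀ h₁) (fun h => F a₁ h - B₂ / 2 * h ^ 2))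
    (c00 : m ≤ F a₀ h₀) (c01 : m ≤ F a₀ h₁) (c10 : m ≤ F a₁ h₀) (c11 : m ≤ F a₁ h₁)
    {a h : ℝ} (hab : a ∈ Icc a₀ a₁) (hhb : h ∈ Icc h₀ h₁) :
    m - (B₁ * (a₁ - a₀) ^ 2 + B₂ * (h₁ - h₀) ^ 2) / 8 ≤ F a h := by
  have e0 : m - B₂ / 8 * (h₁ - h₀) ^ 2 ≤ F a₀ h :=
    interp_lower_min (f := fun h => F a₀ h) hh hB₂ hch₀ hhb c00 c01
  have e1 : m - B₂ / 8 * (h₁ - h₀) ^ 2 ≤ F a₁ h :=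
    interp_lower_min (f := fun h => F a₁ h) hh hB₂ hch₁ hhb c10 c11
  have e := interp_lower_min (f := fun a => F a h) ha hB₁ (hca h hhb) hab e0 e1
  have : m - B₂ / 8 * (h₁ - h₀) ^ 2 - B₁ / 8 * (a₁ - a₀) ^ 2 =
      m - (B₁ * (a₁ - a₀) ^ 2 + B₂ * (h₁ - h₀) ^ 2) / 8 := by ring
  linarith

/-- **The box lemma (second-derivative form).**  `F : ℝ → ℝ → ℝ` with partial derivatives in `a` up to order two
along every horizontal segment of the rectangle, bounded by `B₁`, and in `h` up to order two along the two vertical edges,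
bounded by `B₂`; if `F ≥ m` at the four corners then `F ≥ m − (B₁(a₁−a₀)² + B₂(h₁−h₀)²)/8` on the rectangle.
This is the form instantiated by the near-ledger box certificate (CERT §22): `F(a,h) = zᵀA(a,h)z` for a unit vector
`z`, `B₁ ≥ sup ‖∂²A/∂a²‖`, `B₂ ≥ sup ‖∂²A/∂h²‖`, corners from the exact grid certificates. -/
theorem box_lower_of_deriv2_le {F Fa Faa : ℝ → ℝ → ℝ} {Fh Fhh : ℝ → ℝ → ℝ}
    {a₀ a₁ h₀ h₁ B₁ B₂ m : ℝ} (ha : a₀ < a₁) (hh : h₀ < h₁) (hB₁ : 0 ≤ B₁) (hB₂ : 0 ≤ B₂)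
    (dFa : ∀ h ∈ Icc h₀ h₁, ∀ a ∈ Icc a₀ a₁, HasDerivAt (fun a => F a h) (Fa a h) a)
    (dFaa : ∀ h ∈ Icc h₀ h₁, ∀ a ∈ Icc a₀ a₁, HasDerivAt (fun a => Fa a h) (Faa a h) a)
    (bFaa : ∀ h ∈ Icc h₀ h₁, ∀ a ∈ Icc a₀ a₁, Faa a h ≤ B₁)
    (dFh : ∀ a, (a = a₀ ∨ a = a₁) → ∀ h ∈ Icc h₀ h₁, HasDerivAt (fun h => F a h) (Fh a h) h)
    (dFhh : ∀ a, (a = a₀ ∨ a = a₁) → ∀ h ∈ Icc h₀ h₁, HasDerivAt (fun h => Fh a h) (Fhh a h) h)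
    (bFhh : ∀ a, (a = a₀ ∨ a = a₁) → ∀ h ∈ Icc h₀ h₁, Fhh a h ≤ B₂)
    (c00 : m ≤ F a₀ h₀) (c01 : m ≤ F a₀ h₁) (c10 : m ≤ F a₁ h₀) (c11 : m ≤ F a₁ h₁)
    {a h : ℝ} (hab : a ∈ Icc a₀ a₁) (hhb : h ∈ Icc h₀ h₁) :
    m - (B₁ * (a₁ - a₀) ^ 2 + B₂ * (h₁ - h₀) ^ 2) / 8 ≤ F a h := by
  refine box_lower_of_concave ha hh hB₁ hB₂ ?_ ?_ ?_ c00 c01 c10 c11 hab hhb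
  · intro h' hh'
    exact concave_shift_of_deriv2_le (f := fun a => F a h') (dFa h' hh') (dFaa h' hh') (bFaa h' hh')
  · exact concave_shift_of_deriv2_le (f := fun h => F a₀ h) (dFh a₀ (Or.inl rfl)) (dFhh a₀ (Or.inl rfl))
      (bFhh a₀ (Or.inl rfl))
  · exact concave_shift_of_deriv2_le (f := fun h => F a₁ h) (dFh a₁ (Or.inr rfl)) (dFhh a₁ (Or.inr rfl))
      (bFhh a₁ (Or.inr rfl))

end Summit.AtomisticToContinuum.Crystallization.Theorems.StrictSplittingRuleBirth
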